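import Literature.IUT.LogThetaLattice.LogWallRemarks
import Literature.IUT.LogThetaLattice.PilotWeights
import Mathlib.Analysis.SpecialFunctions.Log.Basic
import HarnessLib

/-!
# [IUTchIII] Rmk 1.2.1 (i) / Rmk 2.4.2 (ii): NON-DEGENERATE witnesses of `WeightConvention` and `PlaceWeights`
# (proof-only sequel of `InterfaceNonVacuity.lean`; no definition, instance or structure is declared)

S. Mochizuki, *Inter-universal Teichmüller theory III*, §1 Remark 1.2.1 (i), kurims manuscript (May 2020)
p. 35 [claim: Mochizuki2012, status: disputed] (IUTchIII §1 Rmk 1.2.1 (i), kurims p.35): "we regard the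
object `Ψ^gp_{†ℱ_v}/Ψ^{μ_N}_{†ℱ_v}` [or `Ψ^×_{†ℱ_v}/Ψ^{μ_N}_{†ℱ_v}`] as being equipped with a weight `N` — i.e.,
which has the effect of ensuring that the log-volume of `Ψ^×_{†ℱ_v}/Ψ^{μ_N}_{†ℱ_v}` is equal to that of
`Ψ^×_{†ℱ_v}`"; §2 Remark 2.4.2 (ii), p. 89 (the weights `[(F_mod)_v : ℚ_{v_ℚ}]`, `log(p_v)` with `p_v = e`,
`log(p_v) = 1` at archimedean `v` [IUTchI, §0], `ord_v(q_v) > 0` at `v ∈ V̲^bad`).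

abc-iut cell, layer L6, §F v1.18p «NV-L6 WAVE» (seat abc-iut-w5-d207, holder of the parameter-record trio
`{PicData, PlaceWeights, WeightConvention}`).  abc-iut-w5-d114's `InterfaceNonVacuity.lean` (p418713)
witnesses the three records DEGENERATELY (`WeightConvention.const`: log-volume constantly `0`;
`PlaceWeights.allBad`: no archimedean place) and says so.  This file adds NON-DEGENERATE witnesses, so that
§4(iii) of the cell's adjudication can record the two interfaces as "witnessed at a genuine reading":

* `WeightConvention.exists_preimage` — for EVERY commutative group `A`, finite-or-not subgroup `μ_N` and EVERY
  upstairs log-volume `v : Set A → Option ℝ` there is a `WeightConvention A μ_N` whose upstairs log-volume IS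
  `v` and whose weight-`N` log-volume of a subset `T ⊆ A/μ_N` is `v` of the (automatically `μ_N`-saturated)
  preimage of `T` — i.e. print's convention read literally: "the log-volume of `Ψ^×/Ψ^{μ_N}` [with weight `N`]
  is equal to that of `Ψ^×`".  The one lemma is that a `μ_N`-saturated `S ⊆ A` is the full preimage of its
  image (`preimage_image_mk_of_saturated`).
* `PlaceWeights.exists_with_archimedean` — on `V = Fin 2` a place record with ONE bad nonarchimedean place
  (`p = 2`: local degree `1`, `log 2 > 0`, `ord(q) = 1`) and ONE ARCHIMEDEAN place (`log(p_∞) = 1`) — the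
  numerics of `F_mod = ℚ`, `V̲ = {2, ∞}`; so the archimedean clause `logp_arc` is exercised non-vacuously.

Theorems only (witnesses inside the proof terms).  HONEST FRAMING: non-vacuity certificates of typed
parameter records; nothing here asserts anything about [IUTchIII] Cor. 3.12; no side is taken.
-/

noncomputable section

namespace Literature.IUT.LogThetaLattice

universe u

/-! ## Rmk 1.2.1 (i): the weight convention realised by preimages -/

/-- A `μ_N`-saturated subset of `A` is the full preimage of its image in `A/μ_N`.
[claim: Mochizuki2012, status: disputed] (IUTchIII §1 Rmk 1.2.1 (i), kurims p.35) -/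
theorem WeightConvention.preimage_image_mk_of_saturated {A : Type u} [CommGroup A] (μN : Subgroup A)
    (S : Set A) (hS : ∀ a ∈ S, ∀ z ∈ μN, z * a ∈ S) :
    (QuotientGroup.mk (s := μN)) ⁻¹' ((QuotientGroup.mk (s := μN)) '' S) = S := by
  ext x
  refine ⟨?_, fun hx => ⟨x, hx, rfl⟩⟩
  rintro ⟨s, hs, h⟩
  have hz : s⁻¹ * x ∈ μN := QuotientGroup.eq.mp h
  have hx : (s⁻¹ * x) * s ∈ S := hS s hs (s⁻¹ * x) hz
  rwa [mul_comm, mul_inv_cancel_left] at hx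

/-- **`WeightConvention A μ_N`, NON-DEGENERATE witness** ([IUTchIII] Rmk 1.2.1 (i), p. 35: "equipped with a
weight `N` … ensuring that the log-volume of `Ψ^×/Ψ^{μ_N}` is equal to that of `Ψ^×`"): for every upstairs
log-volume `v` there is a weight convention with `logVol = v` whose weight-`N` log-volume of `T ⊆ A/μ_N` is
`v (mk⁻¹ T)`; the convention clause holds because a `μ_N`-saturated set is the preimage of its image.
[claim: Mochizuki2012, status: disputed] (IUTchIII §1 Rmk 1.2.1 (i), kurims p.35) -/
theorem WeightConvention.exists_preimage (A : Type u) [CommGroup A] (μN : Subgroup A)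
    (v : Set A → Option ℝ) :
    ∃ W : WeightConvention A μN, W.logVol = v ∧
      ∀ T : Set (A ⧸ μN), W.logVolQuot T = v ((QuotientGroup.mk (s := μN)) ⁻¹' T) :=
  ⟨{ logVol := v
     logVolQuot := fun T => v ((QuotientGroup.mk (s := μN)) ⁻¹' T)
     weight_convention := fun S hS => by
       show v _ = v S
       rw [WeightConvention.preimage_image_mk_of_saturated μN S hS] },
    rfl, fun _ => rfl⟩

/-- `WeightConvention A μ_N` is inhabited with a PRESCRIBED upstairs log-volume (corollary).
[claim: Mochizuki2012, status: disputed] (IUTchIII §1 Rmk 1.2.1 (i), kurims p.35) -/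
theorem WeightConvention.nonempty_of_logVol (A : Type u) [CommGroup A] (μN : Subgroup A)
    (v : Set A → Option ℝ) : ∃ W : WeightConvention A μN, W.logVol = v :=
  let ⟨W, hW, _⟩ := WeightConvention.exists_preimage A μN v
  ⟨W, hW⟩

/-! ## Rmk 2.4.2 (ii): place weights with an archimedean place -/

/-- **`PlaceWeights (Fin 2)`, NON-DEGENERATE witness** (the numerics of `F_mod = ℚ`, `V̲ = {2, ∞}`): place `0`
bad and nonarchimedean (`[ℚ_2 : ℚ_2] = 1`, `log(p_v) = log 2 > 0`, `ord(q) = 1 > 0`), place `1` ARCHIMEDEAN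
(`log(p_∞) = 1`, [IUTchI] §0).  Exercises `logp_arc` non-vacuously (abc-iut-w5-d114's `allBad` has no
archimedean place). [claim: Mochizuki2012, status: disputed] (IUTchIII §2 Rmk 2.4.2 (ii), kurims p.89) -/
theorem PlaceWeights.exists_with_archimedean :
    ∃ W : PlaceWeights (Fin 2), W.isBad 0 ∧ W.isArc 1 ∧ W.logp 0 = Real.log 2 ∧ W.logp 1 = 1 := by
  classical
  refine ⟨{ isBad := fun v => v = 0
            isArc := fun v => v = 1
            not_isArc_of_isBad := fun v hb ha => by rw [hb] at ha; exact absurd ha (by decide)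
            exists_isBad := ⟨0, rfl⟩
            deg := fun _ => 1
            deg_pos := fun _ => Nat.one_pos
            logp := fun v => if v = 1 then 1 else Real.log 2
            logp_pos := fun v => by
              by_cases h : v = 1
              · simp [h]
              · simp [h, Real.log_pos one_lt_two]
            logp_arc := fun v h => by simp [h]
            ordq := fun _ => 1
            ordq_pos := fun _ _ => one_pos }, rfl, rfl, ?_, ?_⟩
  · show (if (0 : Fin 2) = 1 then (1 : ℝ) else Real.log 2) = Real.log 2
    simp
  · show (if (1 : Fin 2) = 1 then (1 : ℝ) else Real.log 2) = 1
    simp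

end Literature.IUT.LogThetaLattice

end
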